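import Summits.QuantumFields.YangMills.Theorems.BalabanLadderNTConjugateResponse
import HarnessLib

/-!
# Crux `NT` / seam `UVSeamRec.stub_floorsEngine` (S-B), residual MF: the EVENT-WITNESS form of the conjugate
# response — variance instead of sup-norm, `MF ≥ δ²·pM` (card `moderate-deviation-event-witness`, kernel-checked)

Helper file (`--supports stmt-QuantumFields-20043`; owner RULINGS R78/R87) of the fleet lead `ym-spine-19353-p1`,
sequel of `…NTConjugateResponse` (p540130), kernel-checking in the tree the first lemmas of crux-ideate card F
`moderate-deviation-event-witness` (seat `ym-cruxidea-19353-1` g6, HOME sketch `SketchF.lean`, rc 0).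
WHICH CLAUSE IT SUPPLIES: the R87 residual **MF(4ε)** of conjunct 2 (two-point floor) of the REGISTERED
`UVSeamRec.stub_floorsEngine` (consumed by p517197 / p518416), from an EVENT witness: the sharper, VARIANCE form of
the RP–Schwarz witness lemma.  For a witness `H ∈ [0,1]` (an event function — the card pins it to a moderate-deviation
event of Bałaban's block field on the collar, via the D1 pin `DirichletResponse.dirichletResponse`, p544670) one has
`Var H ≤ E[H]`, so the sup-norm constant `K²` of `ConjugateResponse.sq_le_sq_mul_cov_negReflect_of_response` is
replaced by the event PROBABILITY:

* §1 `integral_negReflect_mul_le_integral_mul_self` — `∫ H∘ϑ·H ≤ ∫ H²`; **`sq_cov_negReflect_le_cov_mul_var`** —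
  `Cov(F∘ϑ, H)² ≤ Cov(F∘ϑ, F)·Var(H)` (tree RPCS + positivity of the mirror form);
  **`cov_negReflect_self_ge_of_eventResponse`** — (EVT) `pM ≤ E[H]`, (RESP) `δ·E[H] ≤ Cov(F∘ϑ, H)` ⇒
  `δ²·pM ≤ Cov(F∘ϑ, F)`.
* §2 torus forms: `mirrorCov_ge_of_eventWitness` (cylinder observables in a positive-time window) and
  **`mirrorFloor_of_eventWitness`** — MF in EXACTLY the `torusE` shape of p517197/p518416 with `4ε = δ²·pM`, from an
  event witness of the cube-carried smeared density (general `(G, r)`, every `β ≥ 0`, every odd torus).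

HONEST FRAMING.  RP–Schwarz bookkeeping; (EVT)/(RESP) for a pinned event are engine-grade OPEN (measure comparison
in UV-stability format + a one-point boundary response on the event); nothing about NT, the seam or a gap.
[cite: FrohlichIsraelLiebSimon1978, Thm. 2.1; OsterwalderSeiler1978, §2]
-/

set_option autoImplicit false

noncomputable section

open MeasureTheory Finset Filter Topology

namespace Summit.QuantumFields.YangMills.Cruxes.NT.ConjugateResponse

/-! ## §1 The variance form of RP–Schwarz with a witness; event witnesses -/

section RP

open Literature.MathematicalPhysics.QuantumFieldTheory
open Literature.MathematicalPhysics.QuantumFieldTheory.WilsonSiteRP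
open Summit.QuantumFields.YangMills.Cruxes.NT.Reflection
  (sq_cov_negReflect_le_odd_pos integrable_wilson_of_bdd integral_comp_negReflect_odd)

variable {G : Type} [Group G] [TopologicalSpace G] [IsTopologicalGroup G] [CompactSpace G]
  [MeasurableSpace G] [BorelSpace G] {N : ℕ} (ρ : G →* Matrix (Fin N) (Fin N) ℂ)

/-- `∫ H∘ϑ · H ≤ ∫ H·H` on the odd torus `(ℤ/(2S+1))⁴` (through `0 ≤ ∫ (H∘ϑ − H)²` and `ϑ`-invariance of Wilson's
measure). [folklore] -/
theorem integral_negReflect_mul_le_integral_mul_self {S : ℕ} (hρ : Continuous ρ) (β : ℝ)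
    {H : GaugeConfig 4 (2 * S + 1) G → ℝ} (hHm : Measurable H) (hHb : ∃ K : ℝ, ∀ U, |H U| ≤ K) :
    ∫ U, H U.negReflect * H U ∂(wilsonMeasure ρ β) ≤ ∫ U, H U * H U ∂(wilsonMeasure ρ β) := by
  haveI := isProbabilityMeasure_wilsonMeasure (d := 4) (L := 2 * S + 1) ρ hρ β
  obtain ⟨K, hK⟩ := hHb
  have hϑm : Measurable (GaugeConfig.negReflect : GaugeConfig 4 (2 * S + 1) G → GaugeConfig 4 (2 * S + 1) G) :=
    measurable_negReflect
  have hbd2 : ∀ U V : GaugeConfig 4 (2 * S + 1) G, |H U * H V| ≤ K * K := fun U V => by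
    rw [abs_mul]; exact mul_le_mul (hK U) (hK V) (abs_nonneg (H V)) ((abs_nonneg (H U)).trans (hK U))
  have hSS : Integrable (fun U => H U.negReflect * H U.negReflect) (wilsonMeasure ρ β) :=
    integrable_wilson_of_bdd ρ hρ β ((hHm.comp hϑm).mul (hHm.comp hϑm)) ⟨K * K, fun U => hbd2 _ _⟩
  have hSH : Integrable (fun U => H U.negReflect * H U) (wilsonMeasure ρ β) :=
    integrable_wilson_of_bdd ρ hρ β ((hHm.comp hϑm).mul hHm) ⟨K * K, fun U => hbd2 _ _⟩
  have hHH : Integrable (fun U => H U * H U) (wilsonMeasure ρ β) :=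
    integrable_wilson_of_bdd ρ hρ β (hHm.mul hHm) ⟨K * K, fun U => hbd2 _ _⟩
  have hrefl : ∫ U, H U.negReflect * H U.negReflect ∂(wilsonMeasure ρ β) = ∫ U, H U * H U ∂(wilsonMeasure ρ β) :=
    integral_comp_negReflect_odd (d := 4) (L := 2 * S + 1) ρ (S := S) rfl hρ β (fun U => H U * H U)
  have h0 : 0 ≤ ∫ U, (H U.negReflect - H U) ^ 2 ∂(wilsonMeasure ρ β) := integral_nonneg fun U => sq_nonneg _
  have hI2 : Integrable (fun U => 2 * (H U.negReflect * H U)) (wilsonMeasure ρ β) := hSH.const_mul 2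
  have hI3 : Integrable (fun U => H U.negReflect * H U.negReflect - 2 * (H U.negReflect * H U))
      (wilsonMeasure ρ β) := hSS.sub hI2
  have e1 : ∫ U, (H U.negReflect * H U.negReflect - 2 * (H U.negReflect * H U)) + H U * H U ∂(wilsonMeasure ρ β) =
      ∫ U, (H U.negReflect * H U.negReflect - 2 * (H U.negReflect * H U)) ∂(wilsonMeasure ρ β) +
        ∫ U, H U * H U ∂(wilsonMeasure ρ β) := integral_add hI3 hHH
  have e2 : ∫ U, (H U.negReflect * H U.negReflect - 2 * (H U.negReflect * H U)) ∂(wilsonMeasure ρ β) =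
      ∫ U, H U.negReflect * H U.negReflect ∂(wilsonMeasure ρ β) -
        ∫ U, 2 * (H U.negReflect * H U) ∂(wilsonMeasure ρ β) := integral_sub hSS hI2
  have e3 : ∫ U, 2 * (H U.negReflect * H U) ∂(wilsonMeasure ρ β) =
      2 * ∫ U, H U.negReflect * H U ∂(wilsonMeasure ρ β) := integral_const_mul _ _
  have hpt : (fun U : GaugeConfig 4 (2 * S + 1) G => (H U.negReflect - H U) ^ 2) =
      fun U => (H U.negReflect * H U.negReflect - 2 * (H U.negReflect * H U)) + H U * H U := by
    funext U; ring
  rw [hpt, e1, e2, e3, hrefl] at h0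
  linarith

/-- **RP variational inequality, variance form** (the first lemma of card `moderate-deviation-event-witness`).  On
the odd torus `(ℤ/(2S+1))⁴` (`S ≥ 1`, `β ≥ 0`), for bounded measurable real observables `F, H` of the closed
non-negative half: `Cov(F∘ϑ, H)² ≤ Cov(F∘ϑ, F) · Var(H)` — the mirror covariance of `F` dominates the squared
covariance of `F` with ANY reflected witness per unit VARIANCE of the witness (tree RPCS `sq_cov_negReflect_le_odd_pos`
+ `Cov(H∘ϑ, H) ≤ Var H` + `cov_negReflect_self_nonneg`). [cite: FrohlichIsraelLiebSimon1978, Thm. 2.1] -/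
theorem sq_cov_negReflect_le_cov_mul_var {S : ℕ} (hS : 1 ≤ S) (hρ : Continuous ρ)
    {β : ℝ} (hβ : 0 ≤ β) {F H : GaugeConfig 4 (2 * S + 1) G → ℝ} (hFm : Measurable F) (hHm : Measurable H)
    (hFb : ∃ K : ℝ, ∀ U, |F U| ≤ K) (hHb : ∃ K : ℝ, ∀ U, |H U| ≤ K)
    (hFdep : DependsOn F {e : Edge 4 (2 * S + 1) | (e.1 0).val ≤ S ∧ ((e.1.shift e.2) 0).val ≤ S})
    (hHdep : DependsOn H {e : Edge 4 (2 * S + 1) | (e.1 0).val ≤ S ∧ ((e.1.shift e.2) 0).val ≤ S}) :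
    ((∫ U, F U.negReflect * H U ∂(wilsonMeasure ρ β)) -
        (∫ U, F U ∂(wilsonMeasure ρ β)) * (∫ U, H U ∂(wilsonMeasure ρ β))) ^ 2 ≤
      ((∫ U, F U.negReflect * F U ∂(wilsonMeasure ρ β)) - (∫ U, F U ∂(wilsonMeasure ρ β)) ^ 2) *
        ((∫ U, H U * H U ∂(wilsonMeasure ρ β)) - (∫ U, H U ∂(wilsonMeasure ρ β)) ^ 2) := by
  have key := sq_cov_negReflect_le_odd_pos (d := 4) (L := 2 * S + 1) ρ rfl hS hρ hβ hFm hHm hFb hHb hFdep hHdep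
  have hA := cov_negReflect_self_nonneg ρ hS hρ hβ hFm hFb hFdep
  have hB : (∫ U, H U.negReflect * H U ∂(wilsonMeasure ρ β)) - (∫ U, H U ∂(wilsonMeasure ρ β)) ^ 2 ≤
      (∫ U, H U * H U ∂(wilsonMeasure ρ β)) - (∫ U, H U ∂(wilsonMeasure ρ β)) ^ 2 := by
    linarith [integral_negReflect_mul_le_integral_mul_self ρ hρ β hHm hHb]
  exact key.trans (mul_le_mul_of_nonneg_left hB hA)

/-- **Mirror-covariance floor from an EVENT WITNESS.**  `F` an observable and `H ∈ [0,1]` an «event function», both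
of the closed non-negative half of the odd torus `(ℤ/(2S+1))⁴` (`S ≥ 1`, `β ≥ 0`); if the event has probability
(EVT) `∫ H ≥ pM > 0` and the covariance of `F` with the REFLECTED event is at least (RESP) `δ · ∫H` (`δ ≥ 0`: the
conditional mean of `F` on the mirror event exceeds its mean by `δ`), then `Cov(F∘ϑ, F) ≥ δ² · pM`
(`Var H ≤ ∫ H` for `0 ≤ H ≤ 1`, then `sq_cov_negReflect_le_cov_mul_var`). [cite: FrohlichIsraelLiebSimon1978, Thm. 2.1] -/
theorem cov_negReflect_self_ge_of_eventResponse {S : ℕ} (hS : 1 ≤ S) (hρ : Continuous ρ)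
    {β : ℝ} (hβ : 0 ≤ β) {F H : GaugeConfig 4 (2 * S + 1) G → ℝ} (hFm : Measurable F) (hHm : Measurable H)
    (hFb : ∃ K : ℝ, ∀ U, |F U| ≤ K) (h01 : ∀ U, 0 ≤ H U ∧ H U ≤ 1)
    (hFdep : DependsOn F {e : Edge 4 (2 * S + 1) | (e.1 0).val ≤ S ∧ ((e.1.shift e.2) 0).val ≤ S})
    (hHdep : DependsOn H {e : Edge 4 (2 * S + 1) | (e.1 0).val ≤ S ∧ ((e.1.shift e.2) 0).val ≤ S})
    {pM δ : ℝ} (hpM : 0 < pM) (hδ : 0 ≤ δ) (hEv : pM ≤ ∫ U, H U ∂(wilsonMeasure ρ β))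
    (hResp : δ * ∫ U, H U ∂(wilsonMeasure ρ β) ≤
      (∫ U, F U.negReflect * H U ∂(wilsonMeasure ρ β)) -
        (∫ U, F U ∂(wilsonMeasure ρ β)) * (∫ U, H U ∂(wilsonMeasure ρ β))) :
    δ ^ 2 * pM ≤ (∫ U, F U.negReflect * F U ∂(wilsonMeasure ρ β)) - (∫ U, F U ∂(wilsonMeasure ρ β)) ^ 2 := by
  haveI := isProbabilityMeasure_wilsonMeasure (d := 4) (L := 2 * S + 1) ρ hρ β
  have hHb : ∃ K : ℝ, ∀ U, |H U| ≤ K := ⟨1, fun U => by rw [abs_le]; constructor <;> linarith [h01 U]⟩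
  set m : ℝ := ∫ U, H U ∂(wilsonMeasure ρ β) with hm
  set A : ℝ := (∫ U, F U.negReflect * F U ∂(wilsonMeasure ρ β)) - (∫ U, F U ∂(wilsonMeasure ρ β)) ^ 2
    with hAdef
  set X : ℝ := (∫ U, F U.negReflect * H U ∂(wilsonMeasure ρ β)) - (∫ U, F U ∂(wilsonMeasure ρ β)) * m with hX
  have key := sq_cov_negReflect_le_cov_mul_var ρ hS hρ hβ hFm hHm hFb hHb hFdep hHdep
  have hA : 0 ≤ A := cov_negReflect_self_nonneg ρ hS hρ hβ hFm hFb hFdep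
  have hmpos : 0 < m := lt_of_lt_of_le hpM hEv
  -- `Var H ≤ ∫ H` since `H² ≤ H`
  have hHH : ∫ U, H U * H U ∂(wilsonMeasure ρ β) ≤ m := by
    refine integral_mono_of_nonneg (ae_of_all _ fun U => mul_nonneg (h01 U).1 (h01 U).1)
      (integrable_wilson_of_bdd ρ hρ β hHm hHb) (ae_of_all _ fun U => ?_)
    have := h01 U
    nlinarith
  have hV : (∫ U, H U * H U ∂(wilsonMeasure ρ β)) - m ^ 2 ≤ m := by nlinarith [sq_nonneg m]
  have h1 : X ^ 2 ≤ A * m := key.trans (mul_le_mul_of_nonneg_left hV hA)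
  have h2 : (δ * m) ^ 2 ≤ X ^ 2 := by
    have h0 : 0 ≤ δ * m := mul_nonneg hδ hmpos.le
    exact pow_le_pow_left₀ h0 hResp 2
  have h3 : δ ^ 2 * m * m ≤ A * m := by nlinarith
  have h4 : δ ^ 2 * m ≤ A := le_of_mul_le_mul_right h3 hmpos
  calc δ ^ 2 * pM ≤ δ ^ 2 * m := by gcongr
    _ ≤ A := h4

end RP

/-! ## §2 Torus forms: an event witness for a cylinder observable / for the cube-carried smeared density -/

section Torus

open Literature.MathematicalPhysics.QuantumFieldTheory Literature.MathematicalPhysics.QuantumLattice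
open Summit.QuantumFields.YangMills.Cruxes.OSLegsFromFemtoAndGap.DlrCollarTransfer
open Summit.QuantumFields.YangMills.Cruxes.NT.MarkovMirror
  (dependsOn_posHalf_of_window continuous_cubeSmear exists_abs_cubeSmear_le exists_isCylinder_cubeSmear)

variable (G : Type) [Group G] [TopologicalSpace G] [IsTopologicalGroup G] [CompactSpace G]
  [MeasurableSpace G] [BorelSpace G] (r : LatticeRep G)

/-- **Mirror-covariance floor from an event witness, torus form.**  On the torus of side `2L+1` (`L ≥ 1`, `β ≥ 0`):
`W` a bounded continuous cylinder observable with links based at times in `[0, L−1]`, `h ∈ [0,1]` a continuous cylinder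
«event function» with links based at times in `[0, L−1]`; if (EVT) `pM ≤ E_T[h]` and (RESP)
`δ · E_T[h] ≤ Cov_T(W∘Θ₀, h)` (the mean of `W` on the MIRROR event exceeds its torus mean by `δ`), then
`δ² · pM ≤ Cov_T(W∘Θ₀, W)`. [cite: FrohlichIsraelLiebSimon1978, Thm. 2.1] -/
theorem mirrorCov_ge_of_eventWitness {β : ℝ} (hβ : 0 ≤ β) (L : ℕ) (hL : 1 ≤ L)
    {W : LGConfig 4 G → ℝ} (hWc : Continuous W) {MW : ℝ} (hMW : ∀ U, |W U| ≤ MW)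
    {SW : Finset (Literature.MathematicalPhysics.QuantumLattice.ZdEdge 4)} (hWS : IsCylinder W SW)
    (hSW : ∀ e ∈ SW, 0 ≤ e.1 0 ∧ e.1 0 + 1 ≤ (L : ℤ))
    {h : LGConfig 4 G → ℝ} (hhc : Continuous h) (h01 : ∀ U, 0 ≤ h U ∧ h U ≤ 1)
    {Sh : Finset (Literature.MathematicalPhysics.QuantumLattice.ZdEdge 4)} (hhS : IsCylinder h Sh)
    (hSh : ∀ e ∈ Sh, 0 ≤ e.1 0 ∧ e.1 0 + 1 ≤ (L : ℤ))
    {pM δ : ℝ} (hpM : 0 < pM) (hδ : 0 ≤ δ) (hEv : pM ≤ torusE G r β L h)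
    (hResp : δ * torusE G r β L h ≤
      torusE G r β L (fun V => W (cfgReflect V) * h V) - torusE G r β L W * torusE G r β L h) :
    δ ^ 2 * pM ≤ torusE G r β L (fun V => W (cfgReflect V) * W V) -
      torusE G r β L (fun V => W (cfgReflect V)) * torusE G r β L W := by
  haveI := r.secondCountableTopology
  have hposW := dependsOn_posHalf_of_window (G := G) L hWS hSW
  have hposh := dependsOn_posHalf_of_window (G := G) L hhS hSh
  have hWm : Measurable fun U : GaugeConfig 4 (2 * L + 1) G => W (torusLift (2 * L + 1) U) :=
    (hWc.comp (continuous_torusLift _)).measurable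
  have hhm : Measurable fun U : GaugeConfig 4 (2 * L + 1) G => h (torusLift (2 * L + 1) U) :=
    (hhc.comp (continuous_torusLift _)).measurable
  have key := cov_negReflect_self_ge_of_eventResponse r.ρ hL r.continuous hβ
    (F := fun U => W (torusLift (2 * L + 1) U)) (H := fun U => h (torusLift (2 * L + 1) U))
    hWm hhm ⟨MW, fun U => hMW _⟩ (fun U => h01 _) hposW hposh hpM hδ
  rw [torusE_comp_cfgReflect, ← sq]
  unfold torusE at hEv hResp ⊢
  simp only [torusLift_negReflect] at key
  exact key hEv hResp

/-- **MF from an event witness of the cube-carried smeared density** (per torus; general `(G, r)`).  On the torus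
`2L+1` at `β ≥ 0`, `Ṽ = Σ_{y ∈ cube(c,b)} w(y)·dens_y` with `1 ≤ c 0`, `|c 0| + b + 3 ≤ L`; `h ∈ [0,1]` a continuous
cylinder event function of links based at times in `[0, L−1]` with (EVT) `pM ≤ E_T[h]` and (RESP)
`δ·E_T[h] ≤ Cov_T(Ṽ∘Θ₀, h)`; then the bare mirror floor **MF** `δ²·pM ≤ torusE(Ṽ∘Θ₀·Ṽ) − torusE(Ṽ∘Θ₀)·torusE(Ṽ)`
— EXACTLY the clause consumed by `MarkovMirror.lowerBounds_fst_of_bareFloor_chiral` (p517197) and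
`UVSeamRec.MarkovMirrorFloors.stubFloorsEngine_of_bareFloor_rF` (p518416) with `4ε := δ²·pM`.
[cite: FrohlichIsraelLiebSimon1978, Thm. 2.1] -/
theorem mirrorFloor_of_eventWitness {β : ℝ} (hβ : 0 ≤ β) (L : ℕ)
    (c : Fin 4 → ℤ) (b : ℕ) (hc1 : 1 ≤ c 0) (hcL : |((c 0 : ℤ) : ℝ)| + (b : ℝ) + 3 ≤ (L : ℝ))
    (w : (Fin 4 → ℤ) → ℝ)
    {h : LGConfig 4 G → ℝ} (hhc : Continuous h) (h01 : ∀ U, 0 ≤ h U ∧ h U ≤ 1)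
    {Sh : Finset (Literature.MathematicalPhysics.QuantumLattice.ZdEdge 4)} (hhS : IsCylinder h Sh)
    (hSh : ∀ e ∈ Sh, 0 ≤ e.1 0 ∧ e.1 0 + 1 ≤ (L : ℤ))
    {pM δ : ℝ} (hpM : 0 < pM) (hδ : 0 ≤ δ) (hEv : pM ≤ torusE G r β L h)
    (hResp : δ * torusE G r β L h ≤
      torusE G r β L (fun V => (∑ y ∈ cubeSites c b, w y * dens G r y (cfgReflect V)) * h V) -
        torusE G r β L (fun V => ∑ y ∈ cubeSites c b, w y * dens G r y V) * torusE G r β L h) :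
    δ ^ 2 * pM ≤ torusE G r β L (fun V =>
        (∑ y ∈ cubeSites c b, w y * dens G r y (cfgReflect V)) * ∑ y ∈ cubeSites c b, w y * dens G r y V) -
      torusE G r β L (fun V => ∑ y ∈ cubeSites c b, w y * dens G r y (cfgReflect V)) *
        torusE G r β L (fun V => ∑ y ∈ cubeSites c b, w y * dens G r y V) := by
  have hL1 : 1 ≤ L := by
    have h1 : (1 : ℝ) ≤ (c 0 : ℝ) := by exact_mod_cast hc1
    have : (1 : ℝ) ≤ L := by linarith [le_abs_self (((c 0 : ℤ) : ℝ))]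
    exact_mod_cast this
  have hVc := continuous_cubeSmear G r c b w
  obtain ⟨MV, hMV⟩ := exists_abs_cubeSmear_le G r c b w
  obtain ⟨SV, hVS, hSV⟩ := exists_isCylinder_cubeSmear G r c b w
  have hSV' : ∀ e ∈ SV, 0 ≤ e.1 0 ∧ e.1 0 + 1 ≤ (L : ℤ) := by
    intro e he
    have h0 := hSV e he 0
    refine ⟨by linarith [h0.1], ?_⟩
    have : ((e.1 0 : ℤ) : ℝ) + 1 ≤ (L : ℝ) := by
      have h2 : ((e.1 0 : ℤ) : ℝ) ≤ ((c 0 : ℤ) : ℝ) + (b : ℝ) := by exact_mod_cast h0.2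
      linarith [le_abs_self (((c 0 : ℤ) : ℝ))]
    exact_mod_cast this
  exact mirrorCov_ge_of_eventWitness G r hβ L hL1 hVc hMV hVS hSV' hhc h01 hhS hSh hpM hδ hEv hResp

end Torus

end Summit.QuantumFields.YangMills.Cruxes.NT.ConjugateResponse

end
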